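import Mathlib
import Summits.MatrixMultiplication.MatrixMultiplication.Theses.GLnSeparatingDesigns
import Literature.Computability.AlgebraicComplexity.BCGPUInfiniteGroupsProofs
import Literature.Computability.AlgebraicComplexity.SchoenhageTau
import Literature.NumberTheory.DiophantineGeometry.GLPolynomialRepSemisimpleProofs
import Summits.MatrixMultiplication.MatrixMultiplication.Theorems.GLnSeparatingDesignsSeparationDegreeCostStubImageAlgebraSemisimple
import Summits.MatrixMultiplication.MatrixMultiplication.Theorems.GLnSeparatingDesignsSeparationDegreeCostStubBlockIrreducible
import Summits.MatrixMultiplication.MatrixMultiplication.Theorems.GLnSeparatingDesignsSeparationDegreeCostStubMonomialCount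
import Summits.MatrixMultiplication.MatrixMultiplication.Theorems.GLnSeparatingDesignsSeparationDegreeCostStubOperatorSpanRank
import Summits.MatrixMultiplication.MatrixMultiplication.Theorems.GLnSeparatingDesignsSeparationDegreeCostStubClosurePricing
import Summits.MatrixMultiplication.MatrixMultiplication.Theorems.GLnSeparatingDesignsSeparationDegreeCostStubApproxEmbedding
import Summits.MatrixMultiplication.MatrixMultiplication.Theorems.GLnSeparatingDesignsSeparationDegreeCostBlockBound

/-!
# `GLnSeparatingDesigns.SeparationDegreeCost` (stmt-MatrixMultiplication-18361, route
# route-MatrixMultiplication-GLnSeparatingDesigns, rank 3) — BCGPU 2024 Cor. 2.8 with its border clause,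
# PROVED (line `SketchIdeator1`: image-algebra host, big-cell block bound, CHNVZ closure)

The crux: for `n ≥ 3`, `s ≥ 2`, `N₁ N₂ N₃`, if for every `η > 0` there are TPP subsets
`X, Y, Z ⊆ GL_n(ℂ)` of sizes `≥ N₁, N₂, N₃` with `η`-approximate separating polynomials of total
degree `≤ s` in the matrix entries, then `(N₁N₂N₃)^{ω/3} ≤ s^{(n(n-1)/2)(ω-2)} · C(s+n², n²)`
(Blasiak–Cohn–Grochow–Pratt–Umans, arXiv:2410.14905, Cor. 2.8 p. 15 with Thm. 2.6; here without
analyticity in `η`, the border step being the Christandl–Hoeberechts–Nieuwboer–Vrana–Zuiddam closedness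
of the asymptotic-rank sublevel sets). This file is the sorry-free assembly `SeparationDegreeCost_of`;
the seven registered stubs of the line are the imported files `…SeparationDegreeCostStub*.lean` and
`…SeparationDegreeCostBlockBound.lean` (all landed).

## Architecture (cards image-algebra-wedderburn-host + big-cell-block-bound + lsc-closure-pricing of
## Cruxes/SeparationDegreeCost/Ideas, realised in the POLYNOMIAL model)

* Host module: `V = ℂ[x_{ij}]_{≤ s}` (`MvPolynomial.restrictTotalDegree (Fin n × Fin n) ℂ s`) as a
  subrepresentation of the tree's right-translation representation `matTranslRep (Fin n) ℂ`
  (`(R_g p)(x) = p(x g)`; degree is preserved, `totalDegree_matTransl_le`). It is finite-dimensional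
  and completely reducible (tree `isSemisimpleRepresentation_matTranslRep`, Schur–Weyl).
* Image algebra `A = ρ_V(ℂ[GL_n]) ⊆ End V` is semisimple (`stub_isSemisimpleRing_range_asAlgebraHom`),
  so Wedderburn–Artin (Mathlib `IsSemisimpleRing.exists_algEquiv_pi_matrix_of_isAlgClosed`) gives
  `A ≃ₐ ∏ᵢ ℂ^{dᵢ×dᵢ}` and block representations `τᵢ : GL_n(ℂ) → GL_{dᵢ}(ℂ)`; every polynomial
  function `g ↦ p(g) = (R_g p)(1)` of degree `≤ s` is a matrix coefficient of `V`, hence lies in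
  `RepFun(τ)` (`exists_blockFamily`, `exists_hostFamily`).
* `Σ dᵢ² = dim A ≤ dim V = C(s+n²,n²)` (`stub_rank_span_matTransl_domRestrict_le`: `a ↦ (p ↦ (a p)(1))`
  is injective `A → V*` by left-invariance of `V`; `stub_finrank_restrictTotalDegree`: monomial count).
* `dᵢ ≤ s^{n(n-1)/2}` (BCGPU Lemma 2.7 without Weyl's formula): each block is an irreducible
  constituent `W ⊆ V` (`stub_exists_irreducible_finrank_eq_block`), `W = span(U⁻ · v)` for a
  highest-weight vector `v` (tree `span_orbit_eq_lowerSpan`), and the `U⁻`-translate of a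
  column-homogeneous polynomial of column degrees `λ` is one substitution
  `x_{ab} ↦ x_{ab} + Σ_{l>b} c_{lb} x_{al}` whose `c`-support is column-bounded, giving
  `dim W ≤ ∏_j C(λ_j + n-1-j, n-1-j) ≤ s^{C(n,2)}` (`stub_finrank_irreducible_le`).
* Designs: for every `η` the separators `f_{x₀z₀} ∈ RepFun(τ)` make `⟨N₁,N₂,N₃⟩` `η`-close
  (entrywise) to a restriction of `⊕ᵢ ⟨dᵢ,dᵢ,dᵢ⟩` (BCGPU eq. (2.2) with the exact identity
  `γ_{x,z}(α(x',y) β(y',z')) = f_{x,z}(x' y⁻¹ y' z'⁻¹)`; `stub_approxEmbedding`).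
* Closure pricing (`stub_closurePricing`): `R̃(T_η) ≤ R̃(⊕⟨dᵢ⟩) ≤ Σ dᵢ^ω`
  (`asymptoticRank_le_of_polyDegeneratesTo`, `asymptoticRank_matMulDirectSum_le`), the sublevel set
  `{R̃ ≤ Σ dᵢ^ω}` is Euclidean closed (CHNVZ, tree `chnvz_zariskiClosed_asymptoticRank_le_holds`), and
  `(N₁N₂N₃)^{ω/3} ≤ R̃(⟨N₁,N₂,N₃⟩)`.
* Composition `SeparationDegreeCost_of`: host family ∘ approximate embedding ∘ closure pricing ∘
  `Σ dᵢ^ω ≤ (Σ dᵢ²) D^{ω-2}` (`sum_rpow_omega_le_of_le`) with `D = s^{n(n-1)/2}`.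

Disproof used (Cruxes/SeparationDegreeCost/Disproof.lean, refuter cycle 1, NO KILL): the designs are
load-bearing (`separationDegreeCost_false_without_designs`) — here they enter through
`stub_approxEmbedding` at every `η`; the TPP clause is idle (`separationDegreeCost_iff_withoutTPP`) —
indeed `stub_approxEmbedding` never uses it; `cor_2_8_of_separationDegreeCost` then recovers the
vendored exact print `BCGPU2024_cor_2_8` from this file's theorem. No Literature named fact is
assumed: the result is unconditional (axioms propext, Classical.choice, Quot.sound).
-/

-- `Summit.MatrixMultiplication.MatrixMultiplication.…` is the tree's mandated summit-side namespace
-- (single-conjunct summit: Sub = Summit), which the `dupNamespace` linter would flag on every decl.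
set_option linter.dupNamespace false

noncomputable section

open scoped BigOperators
open Literature.Computability.AlgebraicComplexity
open Literature.NumberTheory.DiophantineGeometry MvPolynomial

namespace Summit.MatrixMultiplication.MatrixMultiplication.Theorems

/-! ## The image algebra of a finite-dimensional semisimple representation -/

/-- **Block family of a semisimple representation.** For a finite-dimensional completely reducible
complex representation `ρ` of a group `G`, Wedderburn coordinates `ρ(ℂ[G]) ≃ ∏ᵢ ℂ^{dᵢ×dᵢ}` of the
image algebra give matrix representations `τᵢ : G → GL_{dᵢ}(ℂ)` such that every matrix coefficient
`g ↦ φ (ρ g v)` lies in `RepFun(τ)`, `Σᵢ dᵢ² = dim span{ρ g}`, and each `dᵢ` is the dimension of an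
irreducible subrepresentation of `ρ`. -/
theorem exists_blockFamily {G V : Type*} [Group G] [AddCommGroup V] [Module ℂ V]
    [FiniteDimensional ℂ V] (ρ : Representation ℂ G V) (hρ : ρ.IsSemisimpleRepresentation) :
    ∃ (r : ℕ) (d : Fin r → ℕ) (_ : ∀ i, NeZero (d i))
      (τ : ∀ i, G →* Matrix.GeneralLinearGroup (Fin (d i)) ℂ),
      (∀ (v : V) (φ : Module.Dual ℂ V), (fun g : G => φ (ρ g v)) ∈ repFun d τ) ∧
      ((∑ i, d i ^ 2 : ℕ) : Cardinal) =
        Module.rank ℂ (Submodule.span ℂ (Set.range fun g : G => (ρ g : Module.End ℂ V))) ∧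
      ∀ i, ∃ W : Subrepresentation ρ, W.toRepresentation.IsIrreducible ∧
        Module.finrank ℂ W.toSubmodule = d i := by
  classical
  set A : Subalgebra ℂ (Module.End ℂ V) := (Representation.asAlgebraHom ρ).range with hA
  -- `ρ g ∈ A` and `A = span {ρ g}`
  have hmem : ∀ g : G, ρ g ∈ A := fun g =>
    ⟨MonoidAlgebra.single g 1, Representation.asAlgebraHom_single_one ρ g⟩
  have hspan : Subalgebra.toSubmodule A =
      Submodule.span ℂ (Set.range fun g : G => (ρ g : Module.End ℂ V)) := by
    refine le_antisymm ?_ (Submodule.span_le.2 ?_)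
    · rintro x ⟨a, rfl⟩
      change Representation.asAlgebraHom ρ a ∈ _
      induction a using MonoidAlgebra.induction_on with
      | hM g =>
        rw [MonoidAlgebra.of_apply, Representation.asAlgebraHom_single_one]
        exact Submodule.subset_span ⟨g, rfl⟩
      | hadd a b ha hb => rw [map_add]; exact Submodule.add_mem _ ha hb
      | hsmul r a ha => rw [map_smul]; exact Submodule.smul_mem _ r ha
    · rintro _ ⟨g, rfl⟩
      exact hmem g
  -- Wedderburn coordinates of the (semisimple, finite-dimensional) image algebra
  haveI : IsSemisimpleRing A := stub_isSemisimpleRing_range_asAlgebraHom ρ hρ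
  haveI : FiniteDimensional ℂ A :=
    FiniteDimensional.of_injective A.val.toLinearMap Subtype.val_injective
  obtain ⟨r, d, hd, ⟨e⟩⟩ := IsSemisimpleRing.exists_algEquiv_pi_matrix_of_isAlgClosed ℂ A
  -- the corestriction `G →* A` and the block representations
  let toA : G →* A :=
    { toFun := fun g => ⟨ρ g, hmem g⟩
      map_one' := Subtype.ext (map_one ρ)
      map_mul' := fun g h => Subtype.ext (map_mul ρ g h) }
  let τ : ∀ i, G →* Matrix.GeneralLinearGroup (Fin (d i)) ℂ := fun i =>
    (((Pi.evalRingHom (fun i : Fin r => Matrix (Fin (d i)) (Fin (d i)) ℂ) i).toMonoidHom.comp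
      ((e : A →ₐ[ℂ] BlockAlgebra ℂ d) : A →* BlockAlgebra ℂ d)).comp toA).toHomUnits
  have hτ : ∀ i g, ((τ i g : Matrix.GeneralLinearGroup (Fin (d i)) ℂ) :
      Matrix (Fin (d i)) (Fin (d i)) ℂ) = e (toA g) i := fun i g => rfl
  refine ⟨r, d, hd, τ, ?_, ?_, ?_⟩
  · -- matrix coefficients are in `RepFun`
    intro v φ
    let θ : BlockAlgebra ℂ d →ₗ[ℂ] ℂ :=
      φ ∘ₗ LinearMap.applyₗ v ∘ₗ A.val.toLinearMap ∘ₗ e.symm.toLinearEquiv.toLinearMap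
    have key : (fun g : G => φ (ρ g v)) =
        ∑ k : BlockIndex d, θ (blockBasis ℂ d k) • matrixCoeffFun d τ k := by
      funext g
      have h1 : φ (ρ g v) = θ (e (toA g)) := by
        simp only [θ, LinearMap.comp_apply, LinearEquiv.coe_toLinearMap,
          AlgEquiv.toLinearEquiv_apply, AlgEquiv.symm_apply_apply, AlgHom.toLinearMap_apply,
          Subalgebra.coe_val, LinearMap.applyₗ_apply_apply]
        rfl
      rw [h1, Finset.sum_apply]
      simp only [Pi.smul_apply, smul_eq_mul]
      conv_lhs => rw [← (blockBasis ℂ d).sum_repr (e (toA g)), map_sum]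
      refine Finset.sum_congr rfl fun k _ => ?_
      rw [map_smul, smul_eq_mul, mul_comm]
      congr 1
    rw [repFun_eq_span_range, key]
    exact Submodule.sum_mem _ fun k _ => Submodule.smul_mem _ _ (Submodule.subset_span ⟨k, rfl⟩)
  · -- `Σ dᵢ² = dim A = dim span {ρ g}`
    rw [← hspan]
    have h1 : Module.finrank ℂ (BlockAlgebra ℂ d) = ∑ i, d i ^ 2 := by
      rw [Module.finrank_pi_fintype]
      refine Finset.sum_congr rfl fun i _ => ?_
      rw [Module.finrank_matrix, Fintype.card_fin, Module.finrank_self, mul_one, sq]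
    have h2 : Module.finrank ℂ A = ∑ i, d i ^ 2 := by rw [e.toLinearEquiv.finrank_eq, h1]
    rw [← Module.finrank_eq_rank, Subalgebra.finrank_toSubmodule, h2]
  · intro i
    exact stub_exists_irreducible_finrank_eq_block ρ d e i

/-- **The host family.** For `n ≥ 3`, `s ≥ 2` there are finitely many matrix representations
`ρᵢ : GL_n(ℂ) → GL_{dᵢ}(ℂ)` such that every polynomial function of degree `≤ s` in the matrix
entries lies in `RepFun(ρ)`, with `Σ dᵢ² ≤ C(s+n², n²)` and `dᵢ ≤ s^{n(n-1)/2}`. -/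
theorem exists_hostFamily (n s : ℕ) (hn : 3 ≤ n) (hs : 2 ≤ s) :
    ∃ (r : ℕ) (d : Fin r → ℕ) (_ : ∀ i, NeZero (d i))
      (ρ : ∀ i, GL (Fin n) ℂ →* Matrix.GeneralLinearGroup (Fin (d i)) ℂ),
      (∀ p : MvPolynomial (Fin n × Fin n) ℂ, p.totalDegree ≤ s →
        (fun g : GL (Fin n) ℂ =>
          MvPolynomial.eval (fun ij => (g : Matrix (Fin n) (Fin n) ℂ) ij.1 ij.2) p) ∈ repFun d ρ) ∧
      (∑ i, ((d i : ℕ) : ℝ) ^ 2 ≤ ((s + n ^ 2).choose (n ^ 2) : ℝ)) ∧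
      ∀ i, d i ≤ s ^ (n * (n - 1) / 2) := by
  classical
  -- the polynomials of degree `≤ s`, a finite-dimensional subrepresentation of `ℂ[Mat_n]`
  let V : Subrepresentation (matTranslRep (Fin n) ℂ) :=
    ⟨restrictTotalDegree (Fin n × Fin n) ℂ s, fun g p hp => by
      rw [mem_restrictTotalDegree] at hp ⊢
      exact (totalDegree_matTransl_le _ p).trans hp⟩
  have hVsub : V.toSubmodule = restrictTotalDegree (Fin n × Fin n) ℂ s := rfl
  have hV : ∀ p, p ∈ V.toSubmodule ↔ p.totalDegree ≤ s := fun p => mem_restrictTotalDegree _ _ p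
  let ρV : Representation ℂ (GL (Fin n) ℂ) (restrictTotalDegree (Fin n × Fin n) ℂ s) :=
    V.toRepresentation
  have hss : ρV.IsSemisimpleRepresentation :=
    isSemisimpleRepresentation_toRepresentation V isSemisimpleRepresentation_matTranslRep
  obtain ⟨r, d, hd, τ, hcoef, hdim, hblock⟩ := exists_blockFamily ρV hss
  refine ⟨r, d, hd, τ, ?_, ?_, ?_⟩
  · -- (1) a polynomial function of degree `≤ s` is the matrix coefficient `g ↦ (R_g p)(1)`
    intro p hp
    have hpV : p ∈ restrictTotalDegree (Fin n × Fin n) ℂ s := (mem_restrictTotalDegree _ _ p).2 hp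
    let ev1 : MvPolynomial (Fin n × Fin n) ℂ →ₗ[ℂ] ℂ :=
      (MvPolynomial.aeval fun ij : Fin n × Fin n => (1 : Matrix (Fin n) (Fin n) ℂ) ij.1 ij.2).toLinearMap
    have key : (fun g : GL (Fin n) ℂ =>
        MvPolynomial.eval (fun ij => (g : Matrix (Fin n) (Fin n) ℂ) ij.1 ij.2) p) =
        fun g => (ev1 ∘ₗ (restrictTotalDegree (Fin n × Fin n) ℂ s).subtype) (ρV g ⟨p, hpV⟩) := by
      funext g
      change eval _ p = aeval (fun ij : Fin n × Fin n => (1 : Matrix (Fin n) (Fin n) ℂ) ij.1 ij.2)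
        (matTransl (Fin n) ℂ (g : Matrix (Fin n) (Fin n) ℂ) p)
      have e1 : ∀ q : MvPolynomial (Fin n × Fin n) ℂ,
          aeval (fun ij : Fin n × Fin n => (1 : Matrix (Fin n) (Fin n) ℂ) ij.1 ij.2) q =
            eval (fun ij : Fin n × Fin n => (1 : Matrix (Fin n) (Fin n) ℂ) ij.1 ij.2) q := fun q => rfl
      rw [e1, eval_matTransl]
      congr 2
      funext ij
      simp [Matrix.one_apply]
    rw [key]
    exact hcoef _ _
  · -- (2) `Σ dᵢ² = dim span{R_g|V} ≤ dim V = C(s+n², n²)`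
    -- compose with the inclusion `V ⊆ ℂ[Mat_n]` (injective on operators)
    let Φ : Module.End ℂ (restrictTotalDegree (Fin n × Fin n) ℂ s) →ₗ[ℂ]
        (restrictTotalDegree (Fin n × Fin n) ℂ s →ₗ[ℂ] MvPolynomial (Fin n × Fin n) ℂ) :=
      LinearMap.llcomp ℂ _ _ _ (restrictTotalDegree (Fin n × Fin n) ℂ s).subtype
    have hΦ : Function.Injective Φ := by
      intro f f' hff'
      refine LinearMap.ext fun v => Subtype.ext ?_
      exact LinearMap.congr_fun hff' v
    have hΦρ : (Φ ∘ fun g : GL (Fin n) ℂ => (ρV g : Module.End ℂ _)) = fun g : GL (Fin n) ℂ =>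
        (matTransl (Fin n) ℂ (g : Matrix (Fin n) (Fin n) ℂ)).toLinearMap.domRestrict
          (restrictTotalDegree (Fin n × Fin n) ℂ s) := by
      funext g
      exact LinearMap.ext fun v => rfl
    have hrank : ((∑ i, d i ^ 2 : ℕ) : Cardinal) ≤
        (Module.finrank ℂ (restrictTotalDegree (Fin n × Fin n) ℂ s) : Cardinal) := by
      rw [hdim, (Submodule.equivMapOfInjective Φ hΦ _).rank_eq, Submodule.map_span,
        ← Set.range_comp, hΦρ, Module.finrank_eq_rank]
      exact stub_rank_span_matTransl_domRestrict_le n s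
    have hnat : ∑ i, d i ^ 2 ≤ (s + n ^ 2).choose (n ^ 2) := by
      have h : ∑ i, d i ^ 2 ≤ Module.finrank ℂ (restrictTotalDegree (Fin n × Fin n) ℂ s) := by
        exact_mod_cast hrank
      rwa [stub_finrank_restrictTotalDegree, Fintype.card_prod, Fintype.card_fin, ← sq] at h
    calc ∑ i, ((d i : ℕ) : ℝ) ^ 2 = ((∑ i, d i ^ 2 : ℕ) : ℝ) := by push_cast; rfl
      _ ≤ ((s + n ^ 2).choose (n ^ 2) : ℝ) := by exact_mod_cast hnat
  · -- (3) every block is an irreducible constituent of `V`, of dimension `≤ s^{n(n-1)/2}`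
    intro i
    obtain ⟨W, hWirr, hWd⟩ := hblock i
    rw [← hWd]
    exact stub_finrank_irreducible_le hn hs V hV W hWirr

/-! ## Glue: arithmetic and the composition -/

/-- Real-power bookkeeping: `(s^m)^w = s^{x w}` when `m = x`. -/
theorem natCast_pow_rpow (s m : ℕ) {x : ℝ} (hm : (m : ℝ) = x) (w : ℝ) :
    (((s ^ m : ℕ) : ℝ)) ^ w = (s : ℝ) ^ (x * w) := by
  rw [Nat.cast_pow, ← Real.rpow_natCast, ← Real.rpow_mul (Nat.cast_nonneg _), hm]

/-- `n(n-1)/2` cast to `ℝ` (the product `n(n-1)` is even). -/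
theorem natCast_choose_two_exponent (n : ℕ) (hn : 1 ≤ n) :
    (((n * (n - 1) / 2 : ℕ)) : ℝ) = (n : ℝ) * (n - 1) / 2 := by
  have h2 : (n * (n - 1) / 2 : ℕ) * 2 = n * (n - 1) :=
    Nat.div_mul_cancel (even_iff_two_dvd.mp (Nat.even_mul_pred_self n))
  have h3 : (((n * (n - 1) / 2 : ℕ)) : ℝ) * 2 = (n : ℝ) * ((n - 1 : ℕ) : ℝ) := by
    exact_mod_cast h2
  rw [Nat.cast_sub hn, Nat.cast_one] at h3
  linarith

/-- The final arithmetic: `(N₁N₂N₃)^{ω/3} ≤ Σ dᵢ^ω ≤ (Σ dᵢ²)·D^{ω-2} ≤ C(s+n²,n²)·s^{(n(n-1)/2)(ω-2)}`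
for `D = s^{n(n-1)/2}`. -/
theorem cost_of_blockBounds {r : ℕ} (d : Fin r → ℕ) (n s N₁ N₂ N₃ : ℕ) (hn : 1 ≤ n) (hs : 1 ≤ s)
    (hcl : ((N₁ * N₂ * N₃ : ℕ) : ℝ) ^ (omega ℂ / 3) ≤ ∑ i, ((d i : ℕ) : ℝ) ^ omega ℂ)
    (hsum : ∑ i, ((d i : ℕ) : ℝ) ^ 2 ≤ ((s + n ^ 2).choose (n ^ 2) : ℝ))
    (hblk : ∀ i, d i ≤ s ^ (n * (n - 1) / 2)) :
    ((N₁ : ℝ) * N₂ * N₃) ^ (omega ℂ / 3) ≤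
      (s : ℝ) ^ ((n : ℝ) * (n - 1) / 2 * (omega ℂ - 2)) * ((s + n ^ 2).choose (n ^ 2) : ℝ) := by
  have hD1 : 1 ≤ s ^ (n * (n - 1) / 2) := Nat.one_le_pow _ _ hs
  have h1 := sum_rpow_omega_le_of_le d hD1 hblk (omega_two_le ℂ)
  have hDr : (((s ^ (n * (n - 1) / 2) : ℕ)) : ℝ) ^ (omega ℂ - 2) =
      (s : ℝ) ^ ((n : ℝ) * (n - 1) / 2 * (omega ℂ - 2)) :=
    natCast_pow_rpow s _ (natCast_choose_two_exponent n hn) _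
  have hpos : 0 ≤ (((s ^ (n * (n - 1) / 2) : ℕ)) : ℝ) ^ (omega ℂ - 2) :=
    Real.rpow_nonneg (Nat.cast_nonneg _) _
  have hcast : ((N₁ * N₂ * N₃ : ℕ) : ℝ) = (N₁ : ℝ) * N₂ * N₃ := by push_cast; ring
  rw [← hcast]
  calc ((N₁ * N₂ * N₃ : ℕ) : ℝ) ^ (omega ℂ / 3) ≤ ∑ i, ((d i : ℕ) : ℝ) ^ omega ℂ := hcl
    _ ≤ (∑ i, ((d i : ℕ) : ℝ) ^ 2) * (((s ^ (n * (n - 1) / 2) : ℕ)) : ℝ) ^ (omega ℂ - 2) := h1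
    _ ≤ ((s + n ^ 2).choose (n ^ 2) : ℝ) * (((s ^ (n * (n - 1) / 2) : ℕ)) : ℝ) ^ (omega ℂ - 2) :=
        mul_le_mul_of_nonneg_right hsum hpos
    _ = (s : ℝ) ^ ((n : ℝ) * (n - 1) / 2 * (omega ℂ - 2)) * ((s + n ^ 2).choose (n ^ 2) : ℝ) := by
        rw [hDr, mul_comm]

/-- **Composition.** The crux `SeparationDegreeCost` from the host family, the approximate
embedding and the closure pricing. -/
theorem SeparationDegreeCost_of :
    Summit.MatrixMultiplication.MatrixMultiplication.Theses.GLnSeparatingDesigns.SeparationDegreeCost := by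
  intro n hn s hs N₁ N₂ N₃ hdes
  classical
  obtain ⟨r, d, hd, ρ, hrep, hsum, hblk⟩ := exists_hostFamily n s hn hs
  -- the designs give, for every `η`, an `η`-approximate restriction of `⊕ᵢ ⟨dᵢ,dᵢ,dᵢ⟩`
  have hT : ∀ η : ℝ, 0 < η → ∃ T : Fin N₁ × Fin N₃ → Fin N₁ × Fin N₂ → Fin N₂ × Fin N₃ → ℂ,
      TensorRestrictsTo (matMulDirectSum ℂ d d d) T ∧
        ∀ a b c, ‖T a b c - matMulTensor ℂ N₁ N₂ N₃ a b c‖ ≤ η := by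
    refine stub_approxEmbedding d ρ N₁ N₂ N₃ fun η hη => ?_
    obtain ⟨X, Y, Z, hX, hY, hZ, htpp, hsep⟩ := hdes η hη
    refine ⟨X, Y, Z, hX, hY, hZ, htpp, fun x₀ hx₀ z₀ hz₀ => ?_⟩
    obtain ⟨p, hp, hps⟩ := hsep x₀ hx₀ z₀ hz₀
    -- the separating function `g ↦ p(g)` (kept opaque to avoid costly β-unification)
    obtain ⟨f, hf⟩ : ∃ f : GL (Fin n) ℂ → ℂ, ∀ g, f g =
        MvPolynomial.eval (fun ij => (g : Matrix (Fin n) (Fin n) ℂ) ij.1 ij.2) p := ⟨_, fun g => rfl⟩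
    have hfmem : f ∈ repFun d ρ := by
      have : f = fun g : GL (Fin n) ℂ =>
          MvPolynomial.eval (fun ij => (g : Matrix (Fin n) (Fin n) ℂ) ij.1 ij.2) p := funext hf
      rw [this]
      exact hrep p hp
    refine ⟨f, hfmem, fun x hx y hy y' hy' z hz => ?_⟩
    rw [hf]
    exact hps x hx y hy y' hy' z hz
  -- closure pricing `(N₁N₂N₃)^{ω/3} ≤ Σ dᵢ^ω`, then the block bounds
  exact cost_of_blockBounds d n s N₁ N₂ N₃ (by omega) (by omega)
    (stub_closurePricing d N₁ N₂ N₃ hT) hsum hblk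

end Summit.MatrixMultiplication.MatrixMultiplication.Theorems

end
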